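import Mathlib
import HarnessLib
import Summits.KontsevichZagierPeriods.Zeta5Search.SorokinIntegrandBounds

/-!
# ζ(5) search — the second recursion of Zudilin's nested kernel and the sign of `z` in Lemma 3 (cell `pub-zeta5`, ct-1 g27)

HONEST FRAMING: systematic search; no irrationality claim unless kernel-certified.  Elementary identities and inequalities for the
TYPED `Zudilin2002.nestedQ`; nothing here is an irrationality result, a worthiness exponent or a denominator statement; no
named fact is discharged.

Zudilin (math/0206177, (3)) defines `Q_k(x₁,…,x_k) = 1 − x₁ Q_{k−1}(x₂,…,x_k)` (the typed `nestedQ` on lists) and uses, in the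
proof of Lemma 3, the SECOND recursion

  `Q_k(x₁,…,x_k) = Q_{k−1}(x₁,…,x_{k−1}) + (−1)^k x₁⋯x_k`,  hence  `Q_k = Q_{k−1}·(1 − z x_k)`,
  `z = (−1)^{k+1} x₁⋯x_{k−1}/Q_{k−1}`,  with `z < 0` for `k` even and `0 < z < 1` for `k` odd

(the parity decides which case of Lemma 2 — `BarnesEulerIntegral` (z < 0) or `BarnesEulerIntegralCut` (0 < z ≤ 1) — opens the last
integration).  In the 0-indexed typed setting (`x : Fin (k+1) → ℝ`, last variable `x (Fin.last k)`, `z = (−1)^k ∏_{j<k} x_j / Q_k`):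

* `nestedQ_append_singleton`, `nestedQ_ofFn_snoc` — the second recursion, on lists and on `Fin.snoc x' t`;
* `prod_lt_nestedQ` — for EVEN `k ≥ 2` on the open cube, `∏ x'_j < Q_k(x')`; `z_sign` (`z < 0` for odd `k`, `0 < z < 1` for even
  `k`), `z_lt_one`;
* `nestedQ_snoc_eq_mul` — `Q_{k+1}(x', t) = Q_k(x')·(1 − z t)`; `one_sub_mul_pos` — `1 − z t > 0` for `t ∈ [0,1]` since `z < 1`;
* `cpow_nestedQ_snoc` — the complex-power splitting `Q_{k+1}(x',t)^{−a₀} = Q_k(x')^{−a₀}·(1 − z t)^{−a₀}` (principal `cpow` of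
  positive reals), the form Lemma 3's Fubini step consumes.

Theorems only (no definitions); imports `Zeta5Search/SorokinIntegrandBounds`.
-/

noncomputable section

namespace Summit.KontsevichZagierPeriods.Zeta5Search.NestedQSecondRecursion

open Set
open Literature.NumberTheory.Irrationality.Zudilin2002 (nestedQ)
open Summit.KontsevichZagierPeriods.Zeta5Search.SorokinIntegrandBounds

/-! ### 1. The second recursion -/

/-- **Second recursion of (3), list form**: `Q(l ++ [x]) = Q(l) + (−1)^{|l|+1} (∏ l) x`. -/
theorem nestedQ_append_singleton : ∀ (l : List ℝ) (x : ℝ),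
    nestedQ (l ++ [x]) = nestedQ l + (-1) ^ (l.length + 1) * l.prod * x
  | [], x => by simp [nestedQ]; ring
  | t :: l, x => by
    rw [List.cons_append]
    change 1 - t * nestedQ (l ++ [x]) = (1 - t * nestedQ l) + (-1) ^ ((t :: l).length + 1) * (t :: l).prod * x
    rw [nestedQ_append_singleton l x, List.length_cons, List.prod_cons]
    ring

/-- **Second recursion of (3) on `Fin.snoc`**: `Q_{k+1}(x', t) = Q_k(x') + (−1)^{k+1} (∏_j x'_j) t`. -/
theorem nestedQ_ofFn_snoc {k : ℕ} (x' : Fin k → ℝ) (t : ℝ) :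
    nestedQ (List.ofFn (Fin.snoc x' t : Fin (k + 1) → ℝ)) = nestedQ (List.ofFn x') + (-1) ^ (k + 1) * (∏ j, x' j) * t := by
  rw [List.ofFn_succ', List.concat_eq_append]
  simp only [Fin.snoc_castSucc, Fin.snoc_last]
  rw [nestedQ_append_singleton, List.length_ofFn, Fin.prod_ofFn]

/-- The same for a general `x : Fin (k+1) → ℝ`, split as `(x ∘ castSucc, x (last k))`. -/
theorem nestedQ_ofFn_succ' {k : ℕ} (x : Fin (k + 1) → ℝ) :
    nestedQ (List.ofFn x) = nestedQ (List.ofFn fun j : Fin k => x j.castSucc) + (-1) ^ (k + 1) * (∏ j : Fin k, x j.castSucc) * x (Fin.last k) := by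
  conv_lhs => rw [← Fin.snoc_init_self x]
  exact nestedQ_ofFn_snoc (Fin.init x) (x (Fin.last k))

/-! ### 2. The sign and size of `z` -/

/-- For EVEN `k ≥ 2` (written `k = m + 1` with `m + 1` even) on the open cube: `∏_j x_j < Q_k(x)` — Zudilin's
`x₁⋯x_{k−1} < Q_{k−2} + x₁⋯x_{k−1} = Q_{k−1}` (second recursion with a `+` sign and `Q_{k−2} > 0`). -/
theorem prod_lt_nestedQ {m : ℕ} (hm : Even (m + 1)) {x : Fin (m + 1) → ℝ} (hx : ∀ j, x j ∈ Ioo (0 : ℝ) 1) :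
    ∏ j, x j < nestedQ (List.ofFn x) := by
  rw [nestedQ_ofFn_succ', Fin.prod_univ_castSucc, Even.neg_one_pow hm, one_mul]
  have hQ : 0 < nestedQ (List.ofFn fun j : Fin m => x j.castSucc) := by
    rcases Nat.eq_zero_or_pos m with rfl | hm0
    · simp [nestedQ]
    · exact (nestedQ_ofFn_mem_Ioo hm0 fun j => hx j.castSucc).1
  linarith

/-- **The number `z` of Lemma 3** on the open cube `(0,1)^k`, `k ≥ 1`, `z = (−1)^k ∏_j x_j / Q_k(x)`:
`z < 0` for odd `k`, `0 < z < 1` for even `k`; in either case `z < 1`. -/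
theorem z_sign {k : ℕ} (hk : 1 ≤ k) {x : Fin k → ℝ} (hx : ∀ j, x j ∈ Ioo (0 : ℝ) 1) :
    (Odd k → (-1) ^ k * (∏ j, x j) / nestedQ (List.ofFn x) < 0) ∧
      (Even k → (-1) ^ k * (∏ j, x j) / nestedQ (List.ofFn x) ∈ Ioo (0 : ℝ) 1) := by
  have hQ := nestedQ_ofFn_mem_Ioo hk hx
  have hP : 0 < ∏ j, x j := Finset.prod_pos fun j _ => (hx j).1
  refine ⟨fun hodd => ?_, fun hev => ?_⟩
  · rw [Odd.neg_one_pow hodd]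
    have : 0 < (∏ j, x j) / nestedQ (List.ofFn x) := div_pos hP hQ.1
    rw [neg_one_mul, neg_div]
    linarith
  · rw [Even.neg_one_pow hev, one_mul]
    obtain ⟨m, rfl⟩ : ∃ m, k = m + 1 := ⟨k - 1, by omega⟩
    exact ⟨div_pos hP hQ.1, (div_lt_one hQ.1).2 (prod_lt_nestedQ hev hx)⟩

/-- In either parity, `z < 1`. -/
theorem z_lt_one {k : ℕ} (hk : 1 ≤ k) {x : Fin k → ℝ} (hx : ∀ j, x j ∈ Ioo (0 : ℝ) 1) :
    (-1) ^ k * (∏ j, x j) / nestedQ (List.ofFn x) < 1 := by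
  rcases Nat.even_or_odd k with h | h
  · exact ((z_sign hk hx).2 h).2
  · linarith [(z_sign hk hx).1 h]

/-- `1 − z t > 0` for `t ∈ [0,1]` whenever `z < 1`. -/
theorem one_sub_mul_pos {z t : ℝ} (hz : z < 1) (ht : t ∈ Icc (0 : ℝ) 1) : 0 < 1 - z * t := by
  rcases le_or_gt z 0 with hz0 | hz0
  · nlinarith [ht.1]
  · nlinarith [ht.2]

/-! ### 3. The factorisation `Q_{k+1} = Q_k · (1 − z t)` -/

/-- **Factorisation**: on the open cube (`k ≥ 1`), `Q_{k+1}(x', t) = Q_k(x') · (1 − z t)` with `z = (−1)^k ∏_j x'_j / Q_k(x')`. -/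
theorem nestedQ_snoc_eq_mul {k : ℕ} (hk : 1 ≤ k) {x' : Fin k → ℝ} (hx' : ∀ j, x' j ∈ Ioo (0 : ℝ) 1) (t : ℝ) :
    nestedQ (List.ofFn (Fin.snoc x' t : Fin (k + 1) → ℝ)) =
      nestedQ (List.ofFn x') * (1 - ((-1) ^ k * (∏ j, x' j) / nestedQ (List.ofFn x')) * t) := by
  have hQ := (nestedQ_ofFn_mem_Ioo hk hx').1
  rw [nestedQ_ofFn_snoc, pow_succ]
  field_simp
  ring

/-- **Complex-power splitting for Lemma 3**: on the open cube (`k ≥ 1`), for `t ∈ [0,1]` and any complex exponent `s`,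
`(Q_{k+1}(x',t))^{s} = (Q_k(x'))^{s} · (1 − z t)^{s}` as principal powers of positive reals cast into `ℂ`. -/
theorem cpow_nestedQ_snoc {k : ℕ} (hk : 1 ≤ k) {x' : Fin k → ℝ} (hx' : ∀ j, x' j ∈ Ioo (0 : ℝ) 1) {t : ℝ}
    (ht : t ∈ Icc (0 : ℝ) 1) (s : ℂ) :
    ((nestedQ (List.ofFn (Fin.snoc x' t : Fin (k + 1) → ℝ)) : ℝ) : ℂ) ^ s =
      ((nestedQ (List.ofFn x') : ℝ) : ℂ) ^ s *
        (((1 - ((-1) ^ k * (∏ j, x' j) / nestedQ (List.ofFn x')) * t : ℝ) : ℂ)) ^ s := by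
  rw [nestedQ_snoc_eq_mul hk hx' t, Complex.ofReal_mul]
  exact Complex.mul_cpow_ofReal_nonneg (nestedQ_ofFn_mem_Ioo hk hx').1.le (one_sub_mul_pos (z_lt_one hk hx') ht).le s

end Summit.KontsevichZagierPeriods.Zeta5Search.NestedQSecondRecursion

end
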